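import Summits.ValiantsHypothesis.ValiantsHypothesis.Theses.LacunarySymmetroid
import Summits.ValiantsHypothesis.ValiantsHypothesis.Theorems.SymmetroidPencilBasics

/-!
# `DoorA26` — negative lemma: the door is FALSE modulo `TenTouches` (ten touches lift to a twenty)

Crux `stmt-ValiantsHypothesis-19979` (`Theses.LacunarySymmetroid.DoorA26` = `PosRootLawAt 2 6 19`): every real symmetric
`2 × 2` six-term lacunary pencil has at most `19` distinct positive det-roots.  OPEN, typed, never asserted; this file neither
proves nor refutes it.  It isolates a CONSTRUCTION ITEM `H = TenTouches` under which the door is false, with a two-line mechanism,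
so that the negative side of the door becomes a square-system search target (val-sym-door-p1 g13, 2026-08-28; seat report
DOOR-A-P1-REPORT §67).

## H — ten touches

`TenTouches`: there are exponents `d : Fin 6 → ℕ`, real symmetric `2 × 2` letters `S`, and `21` increasing positive abscissae
`τ 0 < τ 1 < ⋯ < τ 20` such that the evaluated pencil `P(t) = Σ_l t^{d_l} S_l` has `det P(τ j) > 0` at the eleven EVEN positions and
`det P(τ j) = 0 ≠ tr P(τ j)` at the ten ODD positions — the sign pattern `+ 0 + 0 + ⋯ 0 +` of a determinant that is non-negative
with TEN DOUBLE positive roots (`20` roots with multiplicity = the Descartes maximum: a «Descartes-sharp-with-multiplicity» PSD-type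
pencil; the tree's `Census.two_mul_card_posRoots_det_succ_le_of_weakSign` allows at most `10` such touches, `9` occur next to every
census eighteen — the extremal pencils «creep» along the light cone with excursion depths `10⁻⁵ … 10⁻¹⁴`, report §64 (iv), §66 (c)).

## Mechanism (`twenty_of_tenTouches`)

Replace every letter by `S_l − ν·tr(S_l)·1` (same support, still symmetric).  The new pencil is `P(t) − ν·tr P(t)·1`, whose determinant
is `det P(t) − ν(1−ν)·tr² P(t)`: NEGATIVE at the ten odd abscissae (`det = 0`, `tr ≠ 0`) and, for `0 < ν ≤ 1/2` small enough, still
POSITIVE at the eleven even ones; the tree lemma `le_card_posRoots_of_alternating` turns the `20` sign alternations into `20` distinct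
positive det-roots.  Hence `doorA26_false_of_tenTouches : TenTouches → ¬ DoorA26`.  Contrapositive (the positive reading):
**`DoorA26` implies that no symmetric `(2,6)` pencil touches the cone ten times** — a necessary condition for the door of the same
«Descartes minus one» type, for PSD-type pencils, whose extremal count of record is `9`.

Nothing here asserts `TenTouches`; it is a construction item (expected dimension of the ten-touch locus: `18 − 5 − 10 = 3`, unobstructed
by counting; obstructed, if the door holds, by the global inequalities).  Nothing here bears on `DoorA34`, `MatrixDescartes`
(stmt-ValiantsHypothesis-18050) or `VP ≠ VNP`.

[folklore] `det(M − c·1) = det M − c·tr M + c²` for `2 × 2` matrices; intermediate value theorem (tree lemma).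
-/

-- `Summit.ValiantsHypothesis.ValiantsHypothesis.…` repeats a component by the D-0017 layout
-- (single-conjunct summit), which the `dupNamespace` linter flags; the name is mandated.
set_option linter.dupNamespace false

namespace Summit.ValiantsHypothesis.ValiantsHypothesis.Theorems.DoorA26.Negative

open Polynomial Finset
open scoped BigOperators Matrix
open Summit.ValiantsHypothesis.ValiantsHypothesis.Theorems.SymmetroidDescartes (eval_det_pencil le_card_posRoots_of_alternating)

/-- **H (construction item) — TEN TOUCHES.**  A real symmetric `(2,6)` pencil `P(t) = Σ_l t^{d_l} S_l` and abscissae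
`0 < τ 0 < ⋯ < τ 20` with `det P(τ j) > 0` for even `j` and `det P(τ j) = 0 ≠ tr P(τ j)` for odd `j` (ten double-root-type zeros of a
non-negative-type determinant, separated and flanked by positive values).  NOT asserted anywhere. [candidate construction of the cell;
no citation exists] -/
def TenTouches : Prop :=
  ∃ (d : Fin 6 → ℕ) (S : Fin 6 → Matrix (Fin 2) (Fin 2) ℝ) (τ : Fin 21 → ℝ),
    (∀ l, (S l).IsSymm) ∧ StrictMono τ ∧ (∀ j, 0 < τ j) ∧
    (∀ j : Fin 21, Even (j : ℕ) → 0 < (∑ l, τ j ^ d l • S l).det) ∧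
    (∀ j : Fin 21, Odd (j : ℕ) → (∑ l, τ j ^ d l • S l).det = 0 ∧ (∑ l, τ j ^ d l • S l).trace ≠ 0)

/-! ### The trace-shifted letters `S_l − ν·tr(S_l)·1` -/

/-- The shifted letters are symmetric. [folklore] -/
theorem isSymm_shift (S : Matrix (Fin 2) (Fin 2) ℝ) (hS : S.IsSymm) (ν : ℝ) :
    (S - (ν * S.trace) • (1 : Matrix (Fin 2) (Fin 2) ℝ)).IsSymm := by
  unfold Matrix.IsSymm at hS ⊢
  rw [Matrix.transpose_sub, Matrix.transpose_smul, Matrix.transpose_one, hS]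

/-- Evaluating the shifted pencil: `Σ t^{d_l}(S_l − ν tr(S_l) 1) = P(t) − ν·tr P(t)·1`. [folklore] -/
theorem pencil_shift_eval (d : Fin 6 → ℕ) (S : Fin 6 → Matrix (Fin 2) (Fin 2) ℝ) (ν t : ℝ) :
    (∑ l, t ^ d l • (S l - (ν * (S l).trace) • (1 : Matrix (Fin 2) (Fin 2) ℝ)))
      = (∑ l, t ^ d l • S l) - (ν * (∑ l, t ^ d l • S l).trace) • (1 : Matrix (Fin 2) (Fin 2) ℝ) := by
  rw [Matrix.trace_sum]
  simp only [smul_sub, Finset.sum_sub_distrib, Matrix.trace_smul, smul_eq_mul, Finset.mul_sum, Finset.sum_smul, smul_smul]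
  congr 1
  refine Finset.sum_congr rfl fun l _ => ?_
  ring_nf

/-- `det(M − (ν tr M)·1) = det M − ν(1−ν) tr² M` for a `2 × 2` matrix. [folklore] -/
theorem det_sub_trace_smul_one (M : Matrix (Fin 2) (Fin 2) ℝ) (ν : ℝ) :
    (M - (ν * M.trace) • (1 : Matrix (Fin 2) (Fin 2) ℝ)).det = M.det - ν * (1 - ν) * M.trace ^ 2 := by
  rw [Matrix.det_fin_two, Matrix.det_fin_two, Matrix.trace_fin_two]
  simp [Matrix.sub_apply, Matrix.smul_apply]
  ring

/-! ### Ten touches lift to a twenty -/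

/-- **TOUCH-LIFT.**  Under `TenTouches` some real symmetric `(2,6)` pencil (the trace-shifted one, same support) has at least `20`
distinct positive det-roots. [folklore] -/
theorem twenty_of_tenTouches (h : TenTouches) :
    ∃ (d : Fin 6 → ℕ) (S : Fin 6 → Matrix (Fin 2) (Fin 2) ℝ), (∀ l, (S l).IsSymm) ∧
      20 ≤ ((∑ l, (X : ℝ[X]) ^ d l • (S l).map C).det.roots.toFinset.filter (fun t => 0 < t)).card := by
  obtain ⟨d, S, τ, hS, hτ, hpos, heven, hodd⟩ := h
  -- the evaluated pencil, its det and trace at the abscissae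
  obtain ⟨P, hP⟩ : ∃ P : ℝ → Matrix (Fin 2) (Fin 2) ℝ, ∀ t, P t = ∑ l, t ^ d l • S l := ⟨_, fun _ => rfl⟩
  -- a uniform small shift: ν ≤ 1/2 and ν ≤ det/(tr²+1)/2 at every even abscissa
  obtain ⟨ν, hν0, hν1, hνsmall⟩ : ∃ ν : ℝ, 0 < ν ∧ ν ≤ 1 / 2 ∧
      ∀ j : Fin 21, Even (j : ℕ) → ν * (P (τ j)).trace ^ 2 < (P (τ j)).det := by
    let E : Finset (Fin 21) := Finset.univ.filter (fun j => Even (j : ℕ))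
    have hE : E.Nonempty := ⟨0, by simp [E]⟩
    let g : Fin 21 → ℝ := fun j => (P (τ j)).det / ((P (τ j)).trace ^ 2 + 1) / 2
    obtain ⟨j₀, hj₀, hmin⟩ := Finset.exists_min_image E g hE
    refine ⟨min (1 / 2) (g j₀), ?_, min_le_left _ _, ?_⟩
    · refine lt_min (by norm_num) ?_
      have hj₀E : Even (j₀ : ℕ) := (Finset.mem_filter.mp hj₀).2
      have hdet := heven j₀ hj₀E
      rw [← hP] at hdet
      show 0 < (P (τ j₀)).det / ((P (τ j₀)).trace ^ 2 + 1) / 2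
      positivity
    · intro j hj
      have hjE : j ∈ E := Finset.mem_filter.mpr ⟨Finset.mem_univ _, hj⟩
      have hle : min (1 / 2) (g j₀) ≤ g j := (min_le_right _ _).trans (hmin j hjE)
      have hdet := heven j hj
      rw [← hP] at hdet
      have hT2 : 0 ≤ (P (τ j)).trace ^ 2 := sq_nonneg _
      have hg : g j * (P (τ j)).trace ^ 2 < (P (τ j)).det := by
        show (P (τ j)).det / ((P (τ j)).trace ^ 2 + 1) / 2 * (P (τ j)).trace ^ 2 < (P (τ j)).det
        rw [div_div, div_mul_eq_mul_div, div_lt_iff₀ (by positivity)]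
        nlinarith
      calc min (1 / 2) (g j₀) * (P (τ j)).trace ^ 2 ≤ g j * (P (τ j)).trace ^ 2 :=
            mul_le_mul_of_nonneg_right hle hT2
        _ < (P (τ j)).det := hg
  -- the shifted letters
  refine ⟨d, fun l => S l - (ν * (S l).trace) • (1 : Matrix (Fin 2) (Fin 2) ℝ), fun l => isSymm_shift (S l) (hS l) ν, ?_⟩
  apply le_card_posRoots_of_alternating _ 20 τ hτ hpos
  intro j
  have hνν : 0 < ν * (1 - ν) := mul_pos hν0 (by linarith)
  have hνle : ν * (1 - ν) ≤ ν := by nlinarith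
  -- value of the shifted determinant at an abscissa
  have hval : ∀ i : Fin 21, ((∑ l, (X : ℝ[X]) ^ d l •
      (S l - (ν * (S l).trace) • (1 : Matrix (Fin 2) (Fin 2) ℝ)).map C).det).eval (τ i)
        = (P (τ i)).det - ν * (1 - ν) * (P (τ i)).trace ^ 2 := by
    intro i
    rw [eval_det_pencil, pencil_shift_eval, ← hP, det_sub_trace_smul_one]
  have hsign : ∀ i : Fin 21, (Even (i : ℕ) → 0 < (P (τ i)).det - ν * (1 - ν) * (P (τ i)).trace ^ 2) ∧
      (Odd (i : ℕ) → (P (τ i)).det - ν * (1 - ν) * (P (τ i)).trace ^ 2 < 0) := by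
    intro i
    constructor
    · intro hi
      have h1 := hνsmall i hi
      nlinarith [sq_nonneg ((P (τ i)).trace)]
    · intro hi
      obtain ⟨hdet, htr⟩ := hodd i hi
      rw [← hP] at hdet htr
      have hT2 : 0 < (P (τ i)).trace ^ 2 := by positivity
      nlinarith
  rw [hval, hval]
  rcases Nat.even_or_odd (j : ℕ) with hj | hj
  · have hj' : Odd ((j.succ : Fin 21) : ℕ) := by
      rw [Fin.val_succ]; exact hj.add_one
    have hjc : Even ((j.castSucc : Fin 21) : ℕ) := by rw [Fin.val_castSucc]; exact hj
    exact mul_neg_of_pos_of_neg ((hsign _).1 hjc) ((hsign _).2 hj')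
  · have hj' : Even ((j.succ : Fin 21) : ℕ) := by
      rw [Fin.val_succ]; exact hj.add_one
    have hjc : Odd ((j.castSucc : Fin 21) : ℕ) := by rw [Fin.val_castSucc]; exact hj
    exact mul_neg_of_neg_of_pos ((hsign _).2 hjc) ((hsign _).1 hj')

/-- **`DoorA26` is false modulo `TenTouches`.** [folklore] -/
theorem doorA26_false_of_tenTouches (h : TenTouches) :
    ¬ Summit.ValiantsHypothesis.ValiantsHypothesis.Theses.LacunarySymmetroid.DoorA26 := by
  intro hA
  obtain ⟨d, S, hS, h20⟩ := twenty_of_tenTouches h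
  have h19 := hA d S hS
  omega

/-- Contrapositive, the positive reading: the door forbids ten touches. [folklore] -/
theorem not_tenTouches_of_doorA26 (hA : Summit.ValiantsHypothesis.ValiantsHypothesis.Theses.LacunarySymmetroid.DoorA26) :
    ¬ TenTouches :=
  fun h => doorA26_false_of_tenTouches h hA

end Summit.ValiantsHypothesis.ValiantsHypothesis.Theorems.DoorA26.Negative
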